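import Literature.Computability.Complexity.GraphSwapBricks
import Literature.Computability.Complexity.GraphCanonizationLeader
import HarnessLib

/-!
# Graph relabel bricks: relabelling the code of a coloured graph along a permutation is in `FP`

Toolkit in the `FP` string-algebra style of `BrickAlgebra.lean` / `FoldCatBricks.lean` /
`GraphSwapBricks.lean`, written for the discharge programme of `babaiLuks1983_canonicalForm`
(`GraphCanonization.lean`, `GraphCanonizationProofs.lean`, `GraphCanonizationLeader.lean`): every
canonical LABELING algorithm ends by emitting the code `relabelCode k G col e` of the input
relabelled along the labeling `e` it found (and compares such codes to pick the lexicographic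
leader). This file provides that output stage as one `FP` brick, on EVERY labeling presented as
the nested-pair list of unary numerals `permCode e = encList [1^{e 0}, …, 1^{e (k-1)}]`:

* `GraphRelabel.gatherRow`, `GraphRelabel.relabelMat n e M` — the row-major code of the matrix
  `(M[e r, e c])_{r,c}`; entries `getD_relabelMat`; **`GraphRelabel.encode_comap`** — the adjacency
  code (`encodingGraphFin`, `GraphEncodings.lean`) of `G.comap e` is `relabelMat k e (code of G)`;
* `GraphRelabel.encode_colours` — the colour-list code `(encodingFinVec encodingNatBool k).encode col`
  is `⟨1ᵏ, encList [⟨col 0⟩₂, …]⟩`;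
* the bricks `matF` (a `foldCat` of `foldCat`s reading single entries at unary offsets, as in
  `GraphSwap.swapMatFn`) and `colPiece` (items of the colour list at permuted positions), and
* **`GraphRelabel.relabelFn ∈ FP`** with
  **`relabelFn ⟨colGraphCode k G col, permCode e⟩ = relabelCode k G col e`** (`relabelFn_apply`).

## References

* S. Arora, B. Barak, *Computational Complexity: A Modern Approach*, CUP 2009, §0.1 (adjacency
  matrix codes), §1.3 (polynomial time is closed under composition and bounded loops).
* L. Babai, E. M. Luks, *Canonical labeling of graphs*, STOC 1983, §1 (the relabelled graph `X^σ`
  as a string; canonical form = lexicographic leader). [BabaiLuks1983]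
-/

namespace Literature.Computability.Complexity

open _root_.Computability Polynomial Brick Plumb HashBricks GraphSwap

namespace GraphRelabel

/-! ### Concatenations of single symbols -/

/-- A concatenation of `k` one-symbol pieces has length `k`. [folklore] -/
theorem length_ccat_one {g : ℕ → List Bool} : ∀ {k : ℕ}, (∀ c, c < k → (g c).length = 1) →
    (ccat g k).length = k
  | 0, _ => rfl
  | k + 1, h => by
    rw [ccat_succ, List.length_append, length_ccat_one fun c hc => h c (by omega), h k (by omega)]

/-- Entries of a concatenation of one-symbol pieces. [folklore] -/
theorem getD_ccat_one {g : ℕ → List Bool} : ∀ {k : ℕ}, (∀ c, c < k → (g c).length = 1) →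
    ∀ {c : ℕ}, c < k → (ccat g k).getD c false = (g c).getD 0 false
  | 0, _, _, hc => absurd hc (Nat.not_lt_zero _)
  | k + 1, h, c, hc => by
    have hlen : (ccat g k).length = k := length_ccat_one fun c hc => h c (by omega)
    rw [ccat_succ, List.getD_eq_getElem?_getD, List.getD_eq_getElem?_getD]
    rcases Nat.lt_or_ge c k with hck | hck
    · rw [List.getElem?_append_left (by omega), ← List.getD_eq_getElem?_getD,
        ← List.getD_eq_getElem?_getD]
      exact getD_ccat_one (fun c hc => h c (by omega)) hck
    · obtain rfl : c = k := by omega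
      rw [List.getElem?_append_right (by omega), hlen, Nat.sub_self]

/-- Reading one symbol: `(ρ ⇂ m) ↾ 1` has length `1` when `m < |ρ|`. [folklore] -/
theorem length_take_one_drop {ρ : List Bool} {m : ℕ} (h : m < ρ.length) : ((ρ.drop m).take 1).length = 1 := by
  simp; omega

/-- Reading one symbol: the entry read is `ρ[m]`. [folklore] -/
theorem getD_take_one_drop (ρ : List Bool) (m : ℕ) : ((ρ.drop m).take 1).getD 0 false = ρ.getD m false := by
  simp [List.getD_eq_getElem?_getD, List.getElem?_drop]

/-! ### The relabelled matrix -/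

/-- Row `r` of the relabelled matrix, from the row `ρ = row (e r)` of the original: its entries at
`e 0, …, e (n-1)`, read one symbol at a time. [folklore] -/
def gatherRow (n : ℕ) (e : ℕ → ℕ) (ρ : List Bool) : List Bool :=
  ccat (fun c => (ρ.drop (e c)).take 1) n

/-- **The relabelled matrix** `relabelMat n e M`: the row-major code of `(M[e r · n + e c])_{r, c < n}`. [folklore] -/
def relabelMat (n : ℕ) (e : ℕ → ℕ) (M : List Bool) : List Bool :=
  ccat (fun r => gatherRow n e (rowOf n (e r) M)) n

/-- Length of a gathered row. [folklore] -/
theorem length_gatherRow {n : ℕ} {e : ℕ → ℕ} {ρ : List Bool} (he : ∀ c, c < n → e c < ρ.length) :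
    (gatherRow n e ρ).length = n :=
  length_ccat_one fun c hc => length_take_one_drop (he c hc)

/-- A gathered row is never longer than `n`. [folklore] -/
theorem length_gatherRow_le (n : ℕ) (e : ℕ → ℕ) (ρ : List Bool) : (gatherRow n e ρ).length ≤ n := by
  have := Brick.length_ccat_le' (g := fun c => (ρ.drop (e c)).take 1) (b := 1) n fun t _ => by simp
  simpa [gatherRow] using this

/-- Entries of a gathered row: `(gatherRow n e ρ)[c] = ρ[e c]`. [folklore] -/
theorem getD_gatherRow {n : ℕ} {e : ℕ → ℕ} {ρ : List Bool} (he : ∀ c, c < n → e c < ρ.length) {c : ℕ}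
    (hc : c < n) : (gatherRow n e ρ).getD c false = ρ.getD (e c) false := by
  rw [gatherRow, getD_ccat_one (fun c hc => length_take_one_drop (he c hc)) hc, getD_take_one_drop]

/-- `gatherRow` only depends on `e` below `n`. [folklore] -/
theorem gatherRow_congr {n : ℕ} {e e' : ℕ → ℕ} (h : ∀ i, i < n → e i = e' i) (ρ : List Bool) :
    gatherRow n e ρ = gatherRow n e' ρ :=
  ccat_congr fun c hc => by rw [h c hc]

/-- `relabelMat` only depends on `e` below `n`. [folklore] -/
theorem relabelMat_congr {n : ℕ} {e e' : ℕ → ℕ} (h : ∀ i, i < n → e i = e' i) (M : List Bool) :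
    relabelMat n e M = relabelMat n e' M :=
  ccat_congr fun r hr => by
    show gatherRow n e (rowOf n (e r) M) = gatherRow n e' (rowOf n (e' r) M)
    rw [h r hr, gatherRow_congr h]

/-- Length of the relabelled matrix of an `n × n` matrix along a map into `[0, n)`. [folklore] -/
theorem length_relabelMat {n : ℕ} {e : ℕ → ℕ} {M : List Bool} (hM : M.length = n * n)
    (he : ∀ i, i < n → e i < n) : (relabelMat n e M).length = n * n := by
  have hrow : ∀ r, r < n → (rowOf n (e r) M).length = n := fun r hr =>
    length_rowOf (by rw [hM]; exact Nat.mul_le_mul_right _ (he r hr))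
  exact length_ccat_eq (fun r hr => length_gatherRow fun c hc => by rw [hrow r hr]; exact he c hc) n le_rfl

/-- **Entries of the relabelled matrix**: `(relabelMat n e M)[r n + c] = M[e r · n + e c]`. [folklore] -/
theorem getD_relabelMat {n : ℕ} {e : ℕ → ℕ} {M : List Bool} (hM : M.length = n * n)
    (he : ∀ i, i < n → e i < n) {r c : ℕ} (hr : r < n) (hc : c < n) :
    (relabelMat n e M).getD (r * n + c) false = M.getD (e r * n + e c) false := by
  have hrow : ∀ r, r < n → (rowOf n (e r) M).length = n := fun r hr =>
    length_rowOf (by rw [hM]; exact Nat.mul_le_mul_right _ (he r hr))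
  have hlen : ∀ r, r < n → (gatherRow n e (rowOf n (e r) M)).length = n := fun r hr =>
    length_gatherRow fun c hc => by rw [hrow r hr]; exact he c hc
  rw [relabelMat, getD_ccat hlen n le_rfl hr hc,
    getD_gatherRow (fun c hc => by rw [hrow r hr]; exact he c hc) hc, getD_rowOf _ (he c hc)]

/-! ### Permutations as maps on `ℕ`, and the code of the relabelled graph -/

/-- A permutation of `Fin n` as a map on `ℕ` (junk `0` from `n` on). [folklore] -/
def natOf {n : ℕ} (e : Equiv.Perm (Fin n)) (i : ℕ) : ℕ := if h : i < n then ((e ⟨i, h⟩ : Fin n) : ℕ) else 0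

/-- `natOf e i = e i` below `n`. [folklore] -/
theorem natOf_of_lt {n : ℕ} (e : Equiv.Perm (Fin n)) {i : ℕ} (hi : i < n) : natOf e i = ((e ⟨i, hi⟩ : Fin n) : ℕ) := by
  simp [natOf, hi]

/-- `natOf e` maps `[0, n)` into `[0, n)`. [folklore] -/
theorem natOf_lt {n : ℕ} (e : Equiv.Perm (Fin n)) {i : ℕ} (hi : i < n) : natOf e i < n := by
  rw [natOf_of_lt e hi]; exact Fin.is_lt _

/-- **The adjacency code of the relabelled graph is the relabelled matrix**: the code of
`G.comap e` (adjacency `G.Adj (e r) (e c)`) is `relabelMat n (natOf e) (code of G)`.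
[Arora–Barak 2009, §0.1 (adjacency-matrix representation)] [cite: AroraBarak2009, §0.1] -/
theorem encode_comap {n : ℕ} (e : Equiv.Perm (Fin n)) (G : SimpleGraph (Fin n)) :
    (encodingGraphFin n).encode (G.comap e) = relabelMat n (natOf e) ((encodingGraphFin n).encode G) := by
  refine ext_matrix (length_encode _) (length_relabelMat (length_encode G) fun i hi => natOf_lt e hi)
    fun r c hr hc => ?_
  rw [getD_relabelMat (length_encode G) (fun i hi => natOf_lt e hi) hr hc]
  apply Bool.eq_iff_iff.2
  rw [getD_encode_iff _ hr hc]
  have h1 : natOf e r * n + natOf e c = ((e ⟨r, hr⟩ : Fin n) : ℕ) * n + ((e ⟨c, hc⟩ : Fin n) : ℕ) := by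
    rw [natOf_of_lt e hr, natOf_of_lt e hc]
  rw [h1, getD_encode_iff G (Fin.is_lt _) (Fin.is_lt _), SimpleGraph.comap_adj]

/-! ### The colour list -/

/-- The body of a `listBool` code is the nested-pair list code `encList`. [folklore] -/
theorem foldr_boolPair_eq_encList (l : List (List Bool)) :
    l.foldr (fun a acc => boolPair a acc) [] = encList l := by
  induction l with
  | nil => rfl
  | cons a l ih => rw [List.foldr_cons, ih, encList_cons]

/-- **The colour-list code**: `(encodingFinVec encodingNatBool k).encode col = ⟨1ᵏ, encList [⟨col 0⟩₂, …, ⟨col (k-1)⟩₂]⟩`.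
[Arora–Barak 2009, §0.1 (tuples of strings)] [cite: AroraBarak2009, §0.1] -/
theorem encode_colours (k : ℕ) (col : Fin k → ℕ) :
    (encodingFinVec encodingNatBool k).encode col =
      boolPair (ones k) (encList ((List.ofFn col).map encodeNat)) := by
  change boolPair (unaryEncodeNat (List.ofFn col).length)
      ((List.ofFn col).foldr (fun a acc => boolPair (encodeNat a) acc) []) = _
  rw [List.length_ofFn, OracleCompose.unaryEncodeNat_eq_replicate, ← foldr_boolPair_eq_encList,
    List.foldr_map]

/-- Items of the colour list: item `i` is `⟨col i⟩₂`. [folklore] -/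
theorem getD_colours {k : ℕ} (col : Fin k → ℕ) {i : ℕ} (hi : i < k) :
    ((List.ofFn col).map encodeNat).getD i [] = encodeNat (col ⟨i, hi⟩) := by
  rw [List.getD_eq_getElem?_getD, List.getElem?_map, List.getElem?_ofFn]
  simp [hi]

/-- **The permutation code** `permCode e = encList [1^{e 0}, …, 1^{e (k-1)}]`. [folklore] -/
def permCode {k : ℕ} (e : Equiv.Perm (Fin k)) : List Bool :=
  encList (List.ofFn fun i : Fin k => ones (e i))

/-- Items of the permutation code. [folklore] -/
theorem getD_permList {k : ℕ} (e : Equiv.Perm (Fin k)) {i : ℕ} (hi : i < k) :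
    (List.ofFn fun i : Fin k => ones (e i)).getD i [] = ones (natOf e i) := by
  rw [List.getD_eq_getElem?_getD, List.getElem?_ofFn, natOf_of_lt e hi]
  simp [hi]

/-- Lengths of the items of the permutation code, as a map on `ℕ`, agree with `natOf e` below `k`. [folklore] -/
theorem length_getD_permList {k : ℕ} (e : Equiv.Perm (Fin k)) {i : ℕ} (hi : i < k) :
    ((List.ofFn fun i : Fin k => ones (e i)).getD i []).length = natOf e i := by
  rw [getD_permList e hi, List.length_replicate]

/-- The permutation code has length at least `2k` (one frame per vertex). [folklore] -/
theorem two_mul_le_length_permCode {k : ℕ} (e : Equiv.Perm (Fin k)) : 2 * k ≤ (permCode e).length := by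
  unfold permCode
  suffices h : ∀ L : List (List Bool), 2 * L.length ≤ (encList L).length by
    simpa using h (List.ofFn fun i : Fin k => ones (e i))
  intro L
  induction L with
  | nil => simp
  | cons a L ih => rw [encList_cons, length_boolPair, List.length_cons]; omega

/-! ### Items of nested-pair lists at unary positions -/

/-- `nthItemFn ⟨1ʲ, encList L⟩ = L[j]` (`ε` past the end) — the `encList` twin of
`HashBricks.nthItemFn_body`. [folklore] -/
theorem nthItemFn_ones_encList (j : ℕ) (L : List (List Bool)) :
    nthItemFn (boolPair (ones j) (encList L)) = L.getD j [] := by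
  rw [nthItemFn_boolPair, List.length_replicate, sndF_iterate_encList, fstF_encList,
    List.getD_eq_getElem?_getD]
  cases h : L.drop j with
  | nil =>
    rw [List.getElem?_eq_none (List.drop_eq_nil_iff.1 h)]
    rfl
  | cons a l =>
    have : L[j]? = some a := by
      have := List.getElem?_drop (xs := L) (i := j) (j := 0)
      rw [h] at this
      simpa using this.symm
    rw [this]
    rfl

/-! ### The matrix stage: records `x = ⟨M, ⟨1ⁿ, E⟩⟩`, pieces on `⟨x, 1ʳ⟩` and `⟨⟨x, ρ⟩, 1ᶜ⟩` -/

/-- The item `E[r]` (`= 1^{e r}`) of a row-piece record `⟨⟨M, ⟨1ⁿ, E⟩⟩, 1ʳ⟩`. [folklore] -/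
noncomputable def eAtF : List Bool → List Bool := nthItemFn ∘ fanoutFn sndF (sndPow 1 ∘ fstF)

/-- `eAtF ∈ FP`. [folklore] -/
theorem eAtF_mem_FP : eAtF ∈ FP :=
  comp_mem_FP nthItemFn_mem_FP (fanoutFn_mem_FP sndF_mem_FP (comp_mem_FP (sndPow_mem_FP 1) fstF_mem_FP))

/-- Value of `eAtF` on a row-piece record. [folklore] -/
theorem eAtF_rec (M U : List Bool) (L : List (List Bool)) (r : ℕ) :
    eAtF (boolPair (boolPair M (boolPair U (encList L))) (ones r)) = L.getD r [] := by
  simp [eAtF, nthItemFn_ones_encList]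

/-- **The selected row** `row (e r)` of a row-piece record: `take n (drop (|E[r]| · n) M)`, the
offset being the length of `mulLenFn ⟨E[r], 1ⁿ⟩`. [folklore] -/
noncomputable def rowSelF : List Bool → List Bool :=
  takeFn ∘ fanoutFn (nthF 1 ∘ fstF)
    (dropFn ∘ fanoutFn (UnaryOffsets.mulLenFn ∘ fanoutFn eAtF (nthF 1 ∘ fstF)) (fstF ∘ fstF))

/-- `rowSelF ∈ FP`. [cite: AroraBarak2009, §1.3] -/
theorem rowSelF_mem_FP : rowSelF ∈ FP :=
  comp_mem_FP takeFn_mem_FP (fanoutFn_mem_FP (comp_mem_FP (nthF_mem_FP 1) fstF_mem_FP)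
    (comp_mem_FP dropFn_mem_FP (fanoutFn_mem_FP
      (comp_mem_FP UnaryOffsets.mulLenFn_mem_FP (fanoutFn_mem_FP eAtF_mem_FP
        (comp_mem_FP (nthF_mem_FP 1) fstF_mem_FP)))
      (comp_mem_FP fstF_mem_FP fstF_mem_FP))))

/-- Value of `rowSelF` on a row-piece record. [folklore] -/
theorem rowSelF_rec (M : List Bool) (n : ℕ) (L : List (List Bool)) (r : ℕ) :
    rowSelF (boolPair (boolPair M (boolPair (ones n) (encList L))) (ones r)) =
      rowOf n (L.getD r []).length M := by
  simp [rowSelF, rowOf, eAtF_rec]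

/-- **The bit piece** on `⟨⟨x, ρ⟩, 1ᶜ⟩`: the single symbol `ρ[|E[c]|]`. [folklore] -/
noncomputable def bitPiece : List Bool → List Bool :=
  take1Fn ∘ dropFn ∘ fanoutFn (nthItemFn ∘ fanoutFn sndF (sndPow 1 ∘ fstF ∘ fstF)) (sndF ∘ fstF)

/-- `bitPiece ∈ FP`. [cite: AroraBarak2009, §1.3] -/
theorem bitPiece_mem_FP : bitPiece ∈ FP :=
  comp_mem_FP take1Fn_mem_FP (comp_mem_FP dropFn_mem_FP (fanoutFn_mem_FP
    (comp_mem_FP nthItemFn_mem_FP (fanoutFn_mem_FP sndF_mem_FP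
      (comp_mem_FP (sndPow_mem_FP 1) (comp_mem_FP fstF_mem_FP fstF_mem_FP))))
    (comp_mem_FP sndF_mem_FP fstF_mem_FP)))

/-- Value of the bit piece. [folklore] -/
theorem bitPiece_rec (M U ρ : List Bool) (L : List (List Bool)) (c : ℕ) :
    bitPiece (boolPair (boolPair (boolPair M (boolPair U (encList L))) ρ) (ones c)) =
      (ρ.drop (L.getD c []).length).take 1 := by
  simp [bitPiece, take1Fn, nthItemFn_ones_encList]

/-- **The row piece** on `⟨x, 1ʳ⟩`: the concatenation fold of the bit pieces over the selected row,
`gatherRow n |E[·]| (row |E[r]|)`. [cite: AroraBarak2009, §1.3 (bounded loops)] -/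
noncomputable def rowPiece : List Bool → List Bool :=
  foldCat X X bitPiece ∘ fanoutFn (fanoutFn fstF rowSelF) (nthF 1 ∘ fstF)

/-- `rowPiece ∈ FP`. [cite: AroraBarak2009, §1.3 (bounded loops)] -/
theorem rowPiece_mem_FP : rowPiece ∈ FP :=
  comp_mem_FP (foldCat_mem_FP X X bitPiece_mem_FP)
    (fanoutFn_mem_FP (fanoutFn_mem_FP fstF_mem_FP rowSelF_mem_FP) (comp_mem_FP (nthF_mem_FP 1) fstF_mem_FP))

/-- Value of the row piece. [folklore] -/
theorem rowPiece_rec (M : List Bool) (n : ℕ) (L : List (List Bool)) (r : ℕ) :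
    rowPiece (boolPair (boolPair M (boolPair (ones n) (encList L))) (ones r)) =
      gatherRow n (fun c => (L.getD c []).length) (rowOf n (L.getD r []).length M) := by
  rw [rowPiece, Function.comp_apply, fanoutFn_apply, fanoutFn_apply, fstF_boolPair, rowSelF_rec,
    Function.comp_apply, fstF_boolPair, nthF_succ_boolPair, nthF_zero, fstF_boolPair, foldCat_apply]
  · simp only [List.length_replicate]
    exact ccat_congr fun c _ => bitPiece_rec M (ones n) _ L c
  · simp [length_boolPair]; omega
  · intro t _
    rw [bitPiece_rec]
    simp [length_boolPair]; omega

/-- **The matrix brick** `matF ⟨M, ⟨1ⁿ, E⟩⟩ = relabelMat n |E[·]| M`: the concatenation fold of the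
row pieces. [cite: AroraBarak2009, §1.3 (bounded loops)] -/
noncomputable def matF : List Bool → List Bool :=
  foldCat X X rowPiece ∘ fanoutFn id (nthF 1)

/-- **`matF ∈ FP`.** [cite: AroraBarak2009, §1.3 (bounded loops)] -/
theorem matF_mem_FP : matF ∈ FP :=
  comp_mem_FP (foldCat_mem_FP X X rowPiece_mem_FP) (fanoutFn_mem_FP OracleCompose.id_mem_FP (nthF_mem_FP 1))

/-- **Semantics of the matrix brick**, on every bit string `M` and every item list `L`. [folklore] -/
theorem matF_apply (M : List Bool) (n : ℕ) (L : List (List Bool)) :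
    matF (boolPair M (boolPair (ones n) (encList L))) = relabelMat n (fun c => (L.getD c []).length) M := by
  rw [matF, Function.comp_apply, fanoutFn_apply, id, nthF_succ_boolPair, nthF_zero, fstF_boolPair,
    foldCat_apply]
  · simp only [List.length_replicate]
    exact ccat_congr fun r _ => rowPiece_rec M n L r
  · simp [length_boolPair]; omega
  · intro t _
    rw [rowPiece_rec]
    refine (length_gatherRow_le _ _ _).trans ?_
    simp [length_boolPair]; omega

/-! ### The colour stage: records `y = ⟨C, E⟩`, pieces on `⟨y, 1ʳ⟩` -/

/-- **The colour piece** on `⟨⟨C, E⟩, 1ʳ⟩`: the frame `⟨C[|E[r]|], ε⟩`. [folklore] -/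
noncomputable def colPiece : List Bool → List Bool :=
  fanoutFn (nthItemFn ∘ fanoutFn (nthItemFn ∘ fanoutFn sndF (sndF ∘ fstF)) (fstF ∘ fstF)) fun _ => []

/-- `colPiece ∈ FP`. [cite: AroraBarak2009, §1.3] -/
theorem colPiece_mem_FP : colPiece ∈ FP :=
  fanoutFn_mem_FP (comp_mem_FP nthItemFn_mem_FP (fanoutFn_mem_FP
    (comp_mem_FP nthItemFn_mem_FP (fanoutFn_mem_FP sndF_mem_FP (comp_mem_FP sndF_mem_FP fstF_mem_FP)))
    (comp_mem_FP fstF_mem_FP fstF_mem_FP))) (const_mem_FP _)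

/-- Value of the colour piece. [folklore] -/
theorem colPiece_rec (Cl L : List (List Bool)) (r : ℕ) :
    colPiece (boolPair (boolPair (encList Cl) (encList L)) (ones r)) =
      boolPair (Cl.getD (L.getD r []).length []) [] := by
  have h : ∀ u : List Bool, nthItemFn (boolPair u (encList Cl)) = Cl.getD u.length [] := fun u => by
    rw [← nthItemFn_ones_encList u.length Cl]
    simp [nthItemFn_boolPair]
  simp [colPiece, nthItemFn_ones_encList, h]

/-- The colour piece is short. [folklore] -/
theorem length_colPiece_rec_le (Cl L : List (List Bool)) (r : ℕ) :
    (colPiece (boolPair (boolPair (encList Cl) (encList L)) (ones r))).length ≤ 2 * (encList Cl).length + 2 := by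
  rw [colPiece_rec, length_boolPair, List.length_nil, Nat.add_zero]
  have : ∀ (j : ℕ) (Cl : List (List Bool)), (Cl.getD j []).length ≤ (encList Cl).length := by
    intro j Cl
    induction Cl generalizing j with
    | nil => simp
    | cons a Cl ih =>
      cases j with
      | zero => simp only [List.getD_cons_zero, encList_cons, length_boolPair]; omega
      | succ j => simp only [List.getD_cons_succ, encList_cons, length_boolPair]; exact (ih j).trans (by omega)
  have := this (L.getD r []).length Cl
  omega

/-- **The colour brick** `colF ⟨⟨C, E⟩, 1ⁿ⟩ = encList [C[|E[0]|], …, C[|E[n-1]|]]`. [cite: AroraBarak2009, §1.3 (bounded loops)] -/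
noncomputable def colF : List Bool → List Bool := foldCat (Polynomial.C 2 * X + Polynomial.C 2) X colPiece

/-- **`colF ∈ FP`.** [cite: AroraBarak2009, §1.3 (bounded loops)] -/
theorem colF_mem_FP : colF ∈ FP := foldCat_mem_FP _ X colPiece_mem_FP

/-- **Semantics of the colour brick** (for `n ≤ |⟨C, E⟩|` rounds, e.g. `n ≤ |E| / 2`). [folklore] -/
theorem colF_apply (Cl L : List (List Bool)) {n : ℕ} (hn : n ≤ (boolPair (encList Cl) (encList L)).length) :
    colF (boolPair (boolPair (encList Cl) (encList L)) (ones n)) =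
      encList ((List.range n).map fun r => Cl.getD (L.getD r []).length []) := by
  rw [colF, foldCat_apply]
  · simp only [List.length_replicate]
    rw [← Brick.ccat_frame_eq_encList]
    exact ccat_congr fun r _ => colPiece_rec Cl L r
  · simpa using hn
  · intro t _
    refine (length_colPiece_rec_le Cl L t).trans ?_
    simp [length_boolPair]; omega

/-! ### Assembly on `z = ⟨colGraphCode k G col, permCode e⟩ = ⟨⟨⟨⟨k⟩₂, M⟩, ⟨1ᵏ, C⟩⟩, E⟩` -/

/-- The field `⟨k⟩₂`. [folklore] -/
noncomputable def zK : List Bool → List Bool := fstF ∘ fstF ∘ fstF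
/-- The adjacency bits `M`. [folklore] -/
noncomputable def zM : List Bool → List Bool := sndF ∘ fstF ∘ fstF
/-- The vertex ruler `1ᵏ`. [folklore] -/
noncomputable def zU : List Bool → List Bool := fstF ∘ sndF ∘ fstF
/-- The colour list `C`. [folklore] -/
noncomputable def zC : List Bool → List Bool := sndF ∘ sndF ∘ fstF

/-- `zK ∈ FP`. [folklore] -/
theorem zK_mem_FP : zK ∈ FP := comp_mem_FP fstF_mem_FP (comp_mem_FP fstF_mem_FP fstF_mem_FP)
/-- `zM ∈ FP`. [folklore] -/
theorem zM_mem_FP : zM ∈ FP := comp_mem_FP sndF_mem_FP (comp_mem_FP fstF_mem_FP fstF_mem_FP)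
/-- `zU ∈ FP`. [folklore] -/
theorem zU_mem_FP : zU ∈ FP := comp_mem_FP fstF_mem_FP (comp_mem_FP sndF_mem_FP fstF_mem_FP)
/-- `zC ∈ FP`. [folklore] -/
theorem zC_mem_FP : zC ∈ FP := comp_mem_FP sndF_mem_FP (comp_mem_FP sndF_mem_FP fstF_mem_FP)

/-- **The relabel brick**: `⟨⟨⟨k⟩₂, matF ⟨M, ⟨1ᵏ, E⟩⟩⟩, ⟨1ᵏ, colF ⟨⟨C, E⟩, 1ᵏ⟩⟩⟩`. [cite: AroraBarak2009, §1.3] -/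
noncomputable def relabelFn : List Bool → List Bool :=
  fanoutFn (fanoutFn zK (matF ∘ fanoutFn zM (fanoutFn zU sndF)))
    (fanoutFn zU (colF ∘ fanoutFn (fanoutFn zC sndF) zU))

/-- **`relabelFn ∈ FP`.** [cite: AroraBarak2009, §1.3 (composition and bounded loops)] -/
theorem relabelFn_mem_FP : relabelFn ∈ FP :=
  fanoutFn_mem_FP
    (fanoutFn_mem_FP zK_mem_FP (comp_mem_FP matF_mem_FP (fanoutFn_mem_FP zM_mem_FP (fanoutFn_mem_FP zU_mem_FP sndF_mem_FP))))
    (fanoutFn_mem_FP zU_mem_FP (comp_mem_FP colF_mem_FP (fanoutFn_mem_FP (fanoutFn_mem_FP zC_mem_FP sndF_mem_FP) zU_mem_FP)))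

/-- `List.ofFn` as a map over `List.range`. [folklore] -/
theorem ofFn_eq_map_range {α : Type} {k : ℕ} (f : Fin k → α) (g : ℕ → α) (h : ∀ (i : ℕ) (hi : i < k), g i = f ⟨i, hi⟩) :
    List.ofFn f = (List.range k).map g := by
  refine List.ext_getElem (by simp) fun i h1 h2 => ?_
  simp only [List.getElem_ofFn, List.getElem_map, List.getElem_range]
  rw [h i (by simpa using h1)]

/-- **Semantics of the relabel brick**: on the code of a coloured graph and the code of a labeling
`e`, it returns the code of the relabelled coloured graph, `relabelCode k G col e`
(`GraphCanonizationLeader.lean`). [cite: BabaiLuks1983, §1 (the string X^σ)] -/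
theorem relabelFn_apply {k : ℕ} (G : SimpleGraph (Fin k)) (col : Fin k → ℕ) (e : Equiv.Perm (Fin k)) :
    relabelFn (boolPair (colGraphCode k G col) (permCode e)) = relabelCode k G col e := by
  set L := List.ofFn fun i : Fin k => ones (e i) with hL
  have hperm : permCode e = encList L := rfl
  have hLe : ∀ i, i < k → (L.getD i []).length = natOf e i := fun i hi => length_getD_permList e hi
  -- unfold both codes
  rw [relabelCode, colGraphCode, colGraphCode, encodingGraph_encode, encodingGraph_encode, encode_colours,
    encode_colours, hperm]
  simp only [relabelFn, fanoutFn_apply, Function.comp_apply, zK, zM, zU, zC, fstF_boolPair, sndF_boolPair]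
  congr 1
  · -- the matrix
    congr 1
    rw [matF_apply, encode_comap, relabelMat_congr (fun i hi => (hLe i hi))]
  · -- the colours
    congr 1
    rw [colF_apply]
    · congr 1
      symm
      simp only [List.map_ofFn]
      refine ofFn_eq_map_range _ _ fun i hi => ?_
      rw [hLe i hi, natOf_of_lt e hi, List.getD_eq_getElem?_getD, List.getElem?_ofFn]
      simp
    · rw [length_boolPair]
      have := two_mul_le_length_permCode e
      rw [hperm] at this
      omega

end GraphRelabel

end Literature.Computability.Complexity
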